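import Mathlib
import Literature.MathematicalPhysics.QuantumLattice.WilsonDiracAP
import Literature.MathematicalPhysics.QuantumFieldTheory.WilsonEnergyConvexity
import HarnessLib

/-!
# Pure-gauge entropy floor (stub `stub_gaugeFloor` of crux stmt-QuantumFields-9735, line Sketch)

For every `ε > 0` there is `a` with `∫ exp(-β S_W(U)) ∏ₑ dU_e ≥ exp(-(a + εβ) L⁴)` for all `β ≥ 0`
and all torus sides `L`, for the `SU(3)` Wilson action on the four-torus `(ℤ/Lℤ)⁴` under product
Haar probability measure on the links.

Proof: the deficit `3 - Re tr (g₀ g₁ g₂⁻¹ g₃⁻¹)` of ONE plaquette is a continuous function of its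
four link variables vanishing at `(1, 1, 1, 1)`, so there is an open neighbourhood `B ∋ 1` in
`SU(3)` with deficit `< δ := ε / (c + 1)` on `B⁴` (`c` = number of plaquette orientations per
site, so that the torus has `c L⁴` plaquettes). On the product set `B^E` (all `4 L⁴` links in
`B`) the Wilson action is `≤ c L⁴ δ ≤ ε L⁴`, and `Haar^{⊗E}(B^E) = Haar(B)^{4L⁴} = exp(-a L⁴)`
with `a := -4 log Haar(B)` (`Haar(B) > 0`, Haar measure charging non-empty open sets). The
Laplace lower bound `exp(-β ε') · Haar^{⊗E}{S_W ≤ ε'} ≤ ∫ exp(-β S_W)` of the tree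
(`exp_mul_measureReal_le_integral_exp`, `WilsonEnergyConvexity`) with `ε' = ε L⁴` concludes.

-/

noncomputable section

open MeasureTheory Matrix Complex Finset
open Literature.MathematicalPhysics.QuantumFieldTheory Literature.MathematicalPhysics.QuantumLattice
open scoped ComplexConjugate BigOperators ComplexOrder

namespace Summit.QuantumFields.QCD.Theorems.UnquenchedChessboardBoundLine

/-! ### The one-plaquette deficit as a function of four link variables -/

/-- The one-plaquette deficit `3 - Re tr (g₀ g₁ g₂⁻¹ g₃⁻¹)` is continuous in the four link
variables. -/
private theorem continuous_quadDeficit :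
    Continuous fun g : Fin 4 → Matrix.specialUnitaryGroup (Fin 3) ℂ =>
      ((3 : ℕ) : ℝ) - ((fundamentalRep (Fin 3) (g 0 * g 1 * (g 2)⁻¹ * (g 3)⁻¹)).trace).re := by
  have h1 : Continuous fun g : Fin 4 → Matrix.specialUnitaryGroup (Fin 3) ℂ =>
      g 0 * g 1 * (g 2)⁻¹ * (g 3)⁻¹ := by
    fun_prop
  exact continuous_const.sub
    (Complex.continuous_re.comp ((continuous_fundamentalRep (Fin 3)).comp h1).matrix_trace)

/-- A neighbourhood `B ∋ 1` in `SU(3)` such that the one-plaquette deficit is `< δ` whenever all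
four link variables lie in `B` (continuity at the trivial links, where the deficit vanishes, and the
product neighbourhood basis `isOpen_pi_iff'`; `B` is the intersection of the four factors). -/
private theorem exists_nhd_quadDeficit_lt {δ : ℝ} (hδ : 0 < δ) :
    ∃ B : Set (Matrix.specialUnitaryGroup (Fin 3) ℂ), IsOpen B ∧ 1 ∈ B ∧
      ∀ g : Fin 4 → Matrix.specialUnitaryGroup (Fin 3) ℂ, (∀ k, g k ∈ B) →
        ((3 : ℕ) : ℝ) -
          ((fundamentalRep (Fin 3) (g 0 * g 1 * (g 2)⁻¹ * (g 3)⁻¹)).trace).re < δ := by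
  set F : (Fin 4 → Matrix.specialUnitaryGroup (Fin 3) ℂ) → ℝ := fun g =>
    ((3 : ℕ) : ℝ) - ((fundamentalRep (Fin 3) (g 0 * g 1 * (g 2)⁻¹ * (g 3)⁻¹)).trace).re with hF
  have hopen : IsOpen {g | F g < δ} := isOpen_lt continuous_quadDeficit continuous_const
  have h1 : (1 : Fin 4 → Matrix.specialUnitaryGroup (Fin 3) ℂ) ∈ {g | F g < δ} := by
    show F 1 < δ
    have hF1 : F 1 = 0 := by simp [hF, Matrix.trace_one]
    rwa [hF1]
  obtain ⟨u, hu, hsub⟩ := isOpen_pi_iff'.1 hopen 1 h1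
  exact ⟨⋂ k, u k, isOpen_iInter_of_finite fun k => (hu k).1, Set.mem_iInter.2 fun k => (hu k).2,
    fun g hg => hsub (Set.mem_univ_pi.2 fun k => Set.mem_iInter.1 (hg k) k)⟩

/-! ### The Wilson action on the product neighbourhood -/

variable {L : ℕ}

/-- If all links lie in `B` and the one-plaquette deficit is `< δ` on `B⁴`, then
`S_W(U) ≤ #plaquettes · δ` (the four links of the plaquette `(x; i < j)` enter its holonomy as
`U(x,i) U(x+eᵢ,j) U(x+eⱼ,i)⁻¹ U(x,j)⁻¹`). -/
private theorem wilsonAction_le_card_mul [NeZero L]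
    {B : Set (Matrix.specialUnitaryGroup (Fin 3) ℂ)} {δ : ℝ}
    (hB : ∀ g : Fin 4 → Matrix.specialUnitaryGroup (Fin 3) ℂ, (∀ k, g k ∈ B) →
      ((3 : ℕ) : ℝ) - ((fundamentalRep (Fin 3) (g 0 * g 1 * (g 2)⁻¹ * (g 3)⁻¹)).trace).re < δ)
    (U : GaugeConfig 4 L (Matrix.specialUnitaryGroup (Fin 3) ℂ)) (hU : ∀ e, U e ∈ B) :
    wilsonAction (fundamentalRep (Fin 3)) U ≤ Fintype.card (Plaquette 4 L) * δ := by
  have hle : ∀ p : Plaquette 4 L, ((3 : ℕ) : ℝ) -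
      ((fundamentalRep (Fin 3) (plaquetteHolonomy U p.1 p.2.1.1 p.2.1.2)).trace).re ≤ δ :=
    fun p => (hB (fun k => U ((![(p.1, p.2.1.1), (Site.shift p.1 p.2.1.1, p.2.1.2),
      (Site.shift p.1 p.2.1.2, p.2.1.1), (p.1, p.2.1.2)] : Fin 4 → Edge 4 L) k)) fun k => hU _).le
  calc wilsonAction (fundamentalRep (Fin 3)) U
      = ∑ p : Plaquette 4 L, (((3 : ℕ) : ℝ) -
          ((fundamentalRep (Fin 3) (plaquetteHolonomy U p.1 p.2.1.1 p.2.1.2)).trace).re) := rfl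
    _ ≤ ∑ _p : Plaquette 4 L, δ := Finset.sum_le_sum fun p _ => hle p
    _ = Fintype.card (Plaquette 4 L) * δ := by
        rw [Finset.sum_const, nsmul_eq_mul, Finset.card_univ]

/-- `|Λ| = L⁴` sites. -/
private theorem card_site [NeZero L] : Fintype.card (Site 4 L) = L ^ 4 := by
  simp [ZMod.card]

/-- `c L⁴` plaquettes, `c` the number of plaquette orientations per site. -/
private theorem card_plaquette [NeZero L] :
    Fintype.card (Plaquette 4 L) = L ^ 4 * Fintype.card {p : Fin 4 × Fin 4 // p.1 < p.2} := by
  rw [Fintype.card_prod, card_site]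

/-- `4 L⁴` links. -/
private theorem card_edge [NeZero L] : Fintype.card (Edge 4 L) = L ^ 4 * 4 := by
  rw [Fintype.card_prod, card_site, Fintype.card_fin]

/-- Arithmetic: `x c · (ε / (c + 1)) ≤ ε x` for `ε, x, c ≥ 0`. -/
private theorem mul_mul_div_le {ε x c : ℝ} (hε : 0 ≤ ε) (hx : 0 ≤ x) (hc : 0 ≤ c) :
    x * c * (ε / (c + 1)) ≤ ε * x := by
  have h1 : c / (c + 1) ≤ 1 := by
    rw [div_le_one (by linarith)]
    linarith
  calc x * c * (ε / (c + 1)) = ε * x * (c / (c + 1)) := by ring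
    _ ≤ ε * x * 1 := mul_le_mul_of_nonneg_left h1 (mul_nonneg hε hx)
    _ = ε * x := mul_one _

/-! ### The entropy floor -/

/-- **Stub `gaugeFloor`** (pure-gauge entropy floor). For every `ε > 0` there is `a` such that for
all `β ≥ 0` and all torus sides `L`, `∫ exp(-β S_W(U)) ∏ₑ dU_e ≥ exp(-(a + εβ) L⁴)` for the `SU(3)`
Wilson action under product Haar probability measure: restrict to the product of a Haar-positive
neighbourhood `B` of `1 ∈ SU(3)` on every one of the `4L⁴` links, chosen (continuity of the
one-plaquette deficit at the trivial links, `exists_nhd_quadDeficit_lt`) so that every plaquette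
deficit is below `ε / (c + 1)` there; then `S_W ≤ ε L⁴` on `B^E`, `Haar^{⊗E}(B^E) = Haar(B)^{4L⁴}`,
and `a := -4 log Haar(B)` works (Laplace bound `exp_mul_measureReal_le_integral_exp`). -/
theorem stub_gaugeFloor (ε : ℝ) (hε : 0 < ε) :
    ∃ a : ℝ, ∀ β : ℝ, 0 ≤ β → ∀ (L : ℕ) [NeZero L],
      Real.exp (-((a + ε * β) * (L : ℝ) ^ 4)) ≤
        ∫ U, Real.exp (-β * wilsonAction (fundamentalRep (Fin 3)) U)
          ∂(Measure.pi fun _ : Edge 4 L => haarProbability (Matrix.specialUnitaryGroup (Fin 3) ℂ)) := by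
  -- the per-plaquette tolerance `δ = ε / (c + 1)` and the neighbourhood `B`
  obtain ⟨c, hc⟩ : ∃ c : ℕ, Fintype.card {p : Fin 4 × Fin 4 // p.1 < p.2} = c := ⟨_, rfl⟩
  have hδ : 0 < ε / (c + 1) := by positivity
  obtain ⟨B, hBo, h1B, hB⟩ := exists_nhd_quadDeficit_lt hδ
  -- Haar mass of `B`
  haveI : (haarProbability (Matrix.specialUnitaryGroup (Fin 3) ℂ)).IsOpenPosMeasure := by
    unfold haarProbability; infer_instance
  obtain ⟨h, hh⟩ : ∃ h : ℝ, (haarProbability (Matrix.specialUnitaryGroup (Fin 3) ℂ)).real B = h :=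
    ⟨_, rfl⟩
  have hpos : 0 < h := by
    rw [← hh]
    exact ENNReal.toReal_pos (hBo.measure_pos _ ⟨1, h1B⟩).ne' (measure_ne_top _ _)
  refine ⟨-(4 * Real.log h), fun β hβ L _ => ?_⟩
  -- the product set `B^E`, its measure, and the action on it
  have hTreal : (Measure.pi fun _ : Edge 4 L =>
      haarProbability (Matrix.specialUnitaryGroup (Fin 3) ℂ)).real
        (Set.univ.pi fun _ : Edge 4 L => B) = h ^ (L ^ 4 * 4) := by
    rw [measureReal_def, Measure.pi_pi, Finset.prod_const, Finset.card_univ, card_edge,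
      ENNReal.toReal_pow, ← measureReal_def, hh]
  have hTsub : (Set.univ.pi fun _ : Edge 4 L => B) ⊆
      {U : GaugeConfig 4 L (Matrix.specialUnitaryGroup (Fin 3) ℂ) |
        wilsonAction (fundamentalRep (Fin 3)) U ≤ ε * (L : ℝ) ^ 4} := by
    intro U hU
    have h1 := wilsonAction_le_card_mul hB U fun e => hU e (Set.mem_univ e)
    rw [card_plaquette, hc] at h1
    push_cast at h1
    exact h1.trans (mul_mul_div_le hε.le (by positivity) c.cast_nonneg)
  -- the Laplace bound with `ε' = ε L⁴`
  have key := exp_mul_measureReal_le_integral_exp (d := 4) (L := L) (fundamentalRep (Fin 3))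
    (continuous_fundamentalRep (Fin 3)) hβ (ε * (L : ℝ) ^ 4)
  refine le_trans ?_ key
  calc Real.exp (-((-(4 * Real.log h) + ε * β) * (L : ℝ) ^ 4))
      = Real.exp (-β * (ε * (L : ℝ) ^ 4)) * h ^ (L ^ 4 * 4) := by
        rw [← Real.exp_log (pow_pos hpos (L ^ 4 * 4)), ← Real.exp_add, Real.log_pow]
        congr 1
        push_cast
        ring
    _ = Real.exp (-β * (ε * (L : ℝ) ^ 4)) *
          (Measure.pi fun _ : Edge 4 L =>
            haarProbability (Matrix.specialUnitaryGroup (Fin 3) ℂ)).real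
              (Set.univ.pi fun _ : Edge 4 L => B) := by rw [hTreal]
    _ ≤ Real.exp (-β * (ε * (L : ℝ) ^ 4)) *
          (Measure.pi fun _ : Edge 4 L =>
            haarProbability (Matrix.specialUnitaryGroup (Fin 3) ℂ)).real
              {U : GaugeConfig 4 L (Matrix.specialUnitaryGroup (Fin 3) ℂ) |
                wilsonAction (fundamentalRep (Fin 3)) U ≤ ε * (L : ℝ) ^ 4} :=
        mul_le_mul_of_nonneg_left (measureReal_mono hTsub (measure_ne_top _ _))
          (Real.exp_pos _).le

end Summit.QuantumFields.QCD.Theorems.UnquenchedChessboardBoundLine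

end
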